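import Mathlib
import Summits.ValiantsHypothesis.ValiantsHypothesis.Theses.BarrierLever
import Summits.ValiantsHypothesis.ValiantsHypothesis.Theorems.BarrierLeverDefinableEquationsDefs
import Summits.ValiantsHypothesis.ValiantsHypothesis.Theorems.BarrierLeverDefinableEquationsStubRazTopUniversality
import Summits.ValiantsHypothesis.ValiantsHypothesis.Theorems.BarrierLeverDefinableEquationsReduction

/-!
# Crux `BarrierLever.DefinableEquations` (stmt-ValiantsHypothesis-8745), line `registered` — the
# stub in the crux's own vocabulary: UNIFORM BOOLEAN-SUM ANNIHILATORS OF RAZ'S MAP (lead c6)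

`RazAnn(n, b, a)`: some level-`a` boolean sum (`q ≤ N^a`, `L(H), deg H ≤ N^a`, `N = C(2n,n)`) in
the top coefficient variables `topMonomials n` is nonzero and vanishes on the whole image
`razPoint n b` of Raz's universal-circuit map `Γ` (slots `razSlots n b = 4 n^b (n+1)²`) — a
VNP(2^n)-explicit ANNIHILATOR of one explicit degree-`(2n-1)` polynomial map (Chatterjee–Tengse
2023, §1.3, open direction 2: annihilators of explicit maps below VPSPACE-explicitness).

* `eq_of_razAnn` (pointwise, same level): `RazAnn(n, b, a) → Eq(n, b, a)` for `n ≥ 1` — the top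
  coefficients of every `f ∈ SmallCircuits ℂ n b` form a Raz point (`stub_razTopUniversality`),
  and a top witness renamed along `topIncl n` is a witness (`boolSum_rename_sumMap`).
* `definableEquations_of_razAnnihilators` (registered sub-goal, inner name
  `RazAnnihilators.definableEquations_of`; the reshaped skeleton's ONE stub
  `stub_uniformRazAnnihilators` is its hypothesis): `(∃ a ∀ b ∃ n₀ ∀ n ≥ n₀, RazAnn(n, b, a)) →
  DefinableEquations`, same `a`; `io_of_razAnnihilators_io`: the infinitely-often form gives
  `DefEq_io` (what the assembly consumes).
* `razAnn_of_polyShortTableau`, `razAnnihilators_of_polyShortTableauEquation`: the former stub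
  H_poly (`stub_polyShortTableauEquation`, polynomially-short tableau equation at scale `N^c`)
  IMPLIES the new one with `a = 17c + 18` — tableau combinations are boolean sums
  (`tableauSumsDefinable_pow`), and the `degLEMonomials`-level witness renamed back along a
  retraction of `topIncl n` is a top-level witness.  So the new stub is weaker (closer to the
  crux) and `DefinableEquations_of_polyShortTableauEquation` factors through it.

With `…TopEquations.lean` (the crux ⟺ its top-component form `TopEq`): H_poly ⇒ uniform RazAnn ⇒
uniform TopEq ⟺ DefinableEquations; the middle implication reverses as soon as the universal
circuit's output `RazUniversal.outVal y` is given its (true, polynomial) complexity bound, which the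
tree does not yet record.  Pure bookkeeping; no definitions, no facts.
-/

set_option linter.dupNamespace false

noncomputable section

namespace Summit.ValiantsHypothesis.ValiantsHypothesis.Theorems.BarrierLeverDefinableEquations

open MvPolynomial
open Literature.Computability.AlgebraicComplexity Literature.Barriers.ValiantsHypothesis
open scoped BigOperators

namespace RazAnnihilators

/-- **`RazAnn(n, b, a) → Eq(n, b, a)`** for `n ≥ 1` (same level, same `q`): rename the top witness
along `topIncl n`; the top coefficients of `f ∈ SmallCircuits ℂ n b` are a Raz point
(`stub_razTopUniversality`). [folklore] -/
theorem eq_of_razAnn {a b n : ℕ} (hn : 1 ≤ n)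
    (h : ∃ q : ℕ, q ≤ (Nat.choose (2 * n) n) ^ a ∧
      ∃ H : MvPolynomial (↥(topMonomials n) ⊕ Fin q) ℂ,
        complexity H ≤ (Nat.choose (2 * n) n) ^ a ∧ H.totalDegree ≤ (Nat.choose (2 * n) n) ^ a ∧
        boolSum H ≠ 0 ∧
        ∀ y : RazUniversal.Lab (Fin n) n (razSlots n b) → ℂ, eval (razPoint n b y) (boolSum H) = 0) :
    ∃ q : ℕ, q ≤ (Nat.choose (2 * n) n) ^ a ∧
      ∃ H : MvPolynomial (↥(degLEMonomials n) ⊕ Fin q) ℂ,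
        complexity H ≤ (Nat.choose (2 * n) n) ^ a ∧ H.totalDegree ≤ (Nat.choose (2 * n) n) ^ a ∧
        boolSum H ≠ 0 ∧
        ∀ f ∈ SmallCircuits ℂ n b, eval (coeffVector (degLEMonomials n) f) (boolSum H) = 0 := by
  obtain ⟨q, hq, H, hHc, hHd, hne, hvan⟩ := h
  refine ⟨q, hq, MvPolynomial.rename (Sum.map (topIncl n) id) H, ?_, ?_, ?_, ?_⟩
  · exact (complexity_rename_le_holds' _ _).trans hHc
  · exact (MvPolynomial.totalDegree_rename_le _ _).trans hHd
  · rw [boolSum_rename_sumMap]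
    exact fun hz => hne (MvPolynomial.rename_injective _ (topIncl_injective n) (by rw [hz, map_zero]))
  · intro f hf
    rw [boolSum_rename_sumMap, MvPolynomial.eval_rename]
    obtain ⟨y, hy⟩ := stub_razTopUniversality n b hn f hf
    have hpt : (coeffVector (degLEMonomials n) f) ∘ topIncl n = razPoint n b y := by
      funext e
      rw [Function.comp_apply, coeffVector_apply, hy e]
      rfl
    rw [hpt]
    exact hvan y

end RazAnnihilators

/-- **The crux from uniform boolean-sum annihilators of Raz's map** (registered sub-goal, lead c6;
the line's stub in the crux's own vocabulary, tableaux stripped): if ONE level `a` serves every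
size exponent `b` — eventually in `n`, a nonzero level-`a` boolean sum in the top coefficient
variables vanishing on the whole image `razPoint n b` of Raz's universal-circuit map — then
`DefinableEquations` (same `a`).  This is Chatterjee–Tengse's open direction 2 (annihilators of
an explicit polynomial map below VPSPACE-explicitness, here VNP-explicit at scale `2^n`), asked
uniformly in `b`. [folklore] -/
theorem RazAnnihilators.definableEquations_of
    (h : ∃ a : ℕ, ∀ b : ℕ, ∃ n₀ : ℕ, ∀ n ≥ n₀, ∃ q : ℕ, q ≤ (Nat.choose (2 * n) n) ^ a ∧
      ∃ H : MvPolynomial (↥(topMonomials n) ⊕ Fin q) ℂ,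
        complexity H ≤ (Nat.choose (2 * n) n) ^ a ∧ H.totalDegree ≤ (Nat.choose (2 * n) n) ^ a ∧
        boolSum H ≠ 0 ∧
        ∀ y : RazUniversal.Lab (Fin n) n (razSlots n b) → ℂ, eval (razPoint n b y) (boolSum H) = 0) :
    Summit.ValiantsHypothesis.ValiantsHypothesis.Theses.BarrierLever.DefinableEquations := by
  obtain ⟨a, ha⟩ := h
  refine ⟨a, fun b => ?_⟩
  obtain ⟨n₀, hn₀⟩ := ha b
  refine ⟨max n₀ 1, fun n hn => ?_⟩
  exact RazAnnihilators.eq_of_razAnn (le_trans (le_max_right _ _) hn)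
    (hn₀ n (le_trans (le_max_left _ _) hn))

/-- **Raz annihilators infinitely often ⇒ `DefEq_io`** (same level `a`). [folklore] -/
theorem io_of_razAnnihilators_io
    (h : ∃ a : ℕ, ∀ b n₀ : ℕ, ∃ n : ℕ, n₀ ≤ n ∧ ∃ q : ℕ, q ≤ (Nat.choose (2 * n) n) ^ a ∧
      ∃ H : MvPolynomial (↥(topMonomials n) ⊕ Fin q) ℂ,
        complexity H ≤ (Nat.choose (2 * n) n) ^ a ∧ H.totalDegree ≤ (Nat.choose (2 * n) n) ^ a ∧
        boolSum H ≠ 0 ∧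
        ∀ y : RazUniversal.Lab (Fin n) n (razSlots n b) → ℂ, eval (razPoint n b y) (boolSum H) = 0) :
    ∃ a : ℕ, ∀ b n₀ : ℕ, ∃ n : ℕ, n₀ ≤ n ∧ ∃ q : ℕ, q ≤ (Nat.choose (2 * n) n) ^ a ∧
      ∃ H : MvPolynomial (↥(degLEMonomials n) ⊕ Fin q) ℂ,
        complexity H ≤ (Nat.choose (2 * n) n) ^ a ∧ H.totalDegree ≤ (Nat.choose (2 * n) n) ^ a ∧
        boolSum H ≠ 0 ∧
        ∀ f ∈ SmallCircuits ℂ n b, eval (coeffVector (degLEMonomials n) f) (boolSum H) = 0 := by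
  obtain ⟨a, ha⟩ := h
  refine ⟨a, fun b n₀ => ?_⟩
  obtain ⟨n, hn, hrest⟩ := ha b (max n₀ 1)
  exact ⟨n, le_trans (le_max_left _ _) hn,
    RazAnnihilators.eq_of_razAnn (le_trans (le_max_right _ _) hn) hrest⟩


/-! ## The line's registered stub H_poly implies the Raz-annihilator form

Tableau combinations are boolean sums (`tableauSumsDefinable_pow`, level `17c + 18`); the witness
lives on `degLEMonomials n` with `boolSum H = rename (topIncl n) (combPoly τ cf)`, and renaming it
back along a retraction `π` of `topIncl n` (`π ∘ topIncl n = id`, available for `n ≥ 1`) gives a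
witness on `topMonomials n` with `boolSum = combPoly τ cf` itself. -/

/-- **H_poly ⇒ Raz annihilators, pointwise** (`n ≥ 2`, shortness scale `N^c`, level `17c + 18`):
a nonzero short tableau combination vanishing on the Raz image is the boolean sum of a top-level
witness of level `17c + 18`. [folklore] -/
theorem razAnn_of_polyShortTableau {c : ℕ} (hc : 1 ≤ c) {b n : ℕ} (hn : 2 ≤ n)
    (h : ∃ (k : ℕ) (τ : Fin k → TabDatum n) (a : Fin k → ℂ),
      ShortComb ((Nat.choose (2 * n) n) ^ c) τ ∧ combPoly τ a ≠ 0 ∧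
        ∀ y : RazUniversal.Lab (Fin n) n (razSlots n b) → ℂ, eval (razPoint n b y) (combPoly τ a) = 0) :
    ∃ q : ℕ, q ≤ (Nat.choose (2 * n) n) ^ (17 * c + 18) ∧
      ∃ H : MvPolynomial (↥(topMonomials n) ⊕ Fin q) ℂ,
        complexity H ≤ (Nat.choose (2 * n) n) ^ (17 * c + 18) ∧
        H.totalDegree ≤ (Nat.choose (2 * n) n) ^ (17 * c + 18) ∧
        boolSum H ≠ 0 ∧
        ∀ y : RazUniversal.Lab (Fin n) n (razSlots n b) → ℂ, eval (razPoint n b y) (boolSum H) = 0 := by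
  classical
  obtain ⟨k, τ, cf, hshort, hne, hvan⟩ := h
  obtain ⟨q, hq, H, hHc, hHd, hsum⟩ := tableauSumsDefinable_pow c hc n hn k τ cf hshort
  -- a retraction of `topIncl n`: top monomials to themselves, the rest to `x₁^n`
  have hn0 : 0 < n := by omega
  let e₀ : ↥(topMonomials n) := ⟨Finsupp.single ⟨0, hn0⟩ n, by
    show (Finsupp.single (⟨0, hn0⟩ : Fin n) n).degree = n
    exact Finsupp.degree_single _ _⟩
  let π : ↥(degLEMonomials n) → ↥(topMonomials n) := fun m =>
    if hm : (m : Fin n →₀ ℕ).degree = n then ⟨(m : Fin n →₀ ℕ), hm⟩ else e₀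
  have hπ : π ∘ topIncl n = id := by
    funext e
    have he : ((topIncl n e : ↥(degLEMonomials n)) : Fin n →₀ ℕ).degree = n := e.2
    simp only [Function.comp_apply, id_eq, π, dif_pos he]
    rfl
  refine ⟨q, hq, MvPolynomial.rename (Sum.map π id) H, ?_, ?_, ?_, ?_⟩
  · exact (complexity_rename_le_holds' _ _).trans hHc
  · exact (MvPolynomial.totalDegree_rename_le _ _).trans hHd
  · rw [boolSum_rename_sumMap, hsum, MvPolynomial.rename_rename, hπ, MvPolynomial.rename_id_apply]
    exact hne
  · intro y
    rw [boolSum_rename_sumMap, hsum, MvPolynomial.rename_rename, hπ, MvPolynomial.rename_id_apply]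
    exact hvan y

/-- **H_poly ⇒ uniform Raz annihilators**: the registered stub `stub_polyShortTableauEquation` of
line `registered` (some `c ≥ 1`, every `b`, eventually in `n`) gives the hypothesis of
`definableEquations_of_razAnnihilators` with `a = 17c + 18`; so the reduction
`DefinableEquations_of_polyShortTableauEquation` factors through the Raz-annihilator form and the
top-component normal form. [folklore] -/
theorem razAnnihilators_of_polyShortTableauEquation
    (h : ∃ c : ℕ, 1 ≤ c ∧ ∀ b : ℕ, ∃ n₀ : ℕ, ∀ n ≥ n₀, ∃ (k : ℕ) (τ : Fin k → TabDatum n) (a : Fin k → ℂ),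
      ShortComb ((Nat.choose (2 * n) n) ^ c) τ ∧ combPoly τ a ≠ 0 ∧
        ∀ y : RazUniversal.Lab (Fin n) n (razSlots n b) → ℂ, eval (razPoint n b y) (combPoly τ a) = 0) :
    ∃ a : ℕ, ∀ b : ℕ, ∃ n₀ : ℕ, ∀ n ≥ n₀, ∃ q : ℕ, q ≤ (Nat.choose (2 * n) n) ^ a ∧
      ∃ H : MvPolynomial (↥(topMonomials n) ⊕ Fin q) ℂ,
        complexity H ≤ (Nat.choose (2 * n) n) ^ a ∧ H.totalDegree ≤ (Nat.choose (2 * n) n) ^ a ∧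
        boolSum H ≠ 0 ∧
        ∀ y : RazUniversal.Lab (Fin n) n (razSlots n b) → ℂ, eval (razPoint n b y) (boolSum H) = 0 := by
  obtain ⟨c, hc, h⟩ := h
  refine ⟨17 * c + 18, fun b => ?_⟩
  obtain ⟨n₀, hn₀⟩ := h b
  refine ⟨max n₀ 2, fun n hn => ?_⟩
  exact razAnn_of_polyShortTableau hc (le_trans (le_max_right _ _) hn)
    (hn₀ n (le_trans (le_max_left _ _) hn))

/-- **Registered sub-goal `definableEquations_of_razAnnihilators` (verbatim signature).**  Uniform
boolean-sum annihilators of Raz's top-coefficient map give the crux, same level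
(`RazAnnihilators.definableEquations_of`). [folklore] -/
theorem definableEquations_of_razAnnihilators : (∃ a : ℕ, ∀ b : ℕ, ∃ n₀ : ℕ, ∀ n ≥ n₀, ∃ q : ℕ, q ≤ (Nat.choose (2 * n) n) ^ a ∧ ∃ H : MvPolynomial (↥(Summit.ValiantsHypothesis.ValiantsHypothesis.Theorems.BarrierLeverDefinableEquations.topMonomials n) ⊕ Fin q) ℂ, Literature.Computability.AlgebraicComplexity.complexity H ≤ (Nat.choose (2 * n) n) ^ a ∧ H.totalDegree ≤ (Nat.choose (2 * n) n) ^ a ∧ Literature.Computability.AlgebraicComplexity.boolSum H ≠ 0 ∧ ∀ y : Literature.Computability.AlgebraicComplexity.RazUniversal.Lab (Fin n) n (Summit.ValiantsHypothesis.ValiantsHypothesis.Theorems.BarrierLeverDefinableEquations.razSlots n b) → ℂ, MvPolynomial.eval (Summit.ValiantsHypothesis.ValiantsHypothesis.Theorems.BarrierLeverDefinableEquations.razPoint n b y) (Literature.Computability.AlgebraicComplexity.boolSum H) = 0) → Summit.ValiantsHypothesis.ValiantsHypothesis.Theses.BarrierLever.DefinableEquations :=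
  fun h => RazAnnihilators.definableEquations_of h

end Summit.ValiantsHypothesis.ValiantsHypothesis.Theorems.BarrierLeverDefinableEquations

end
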